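import Mathlib
import Summits.CriticalPhenomena.Ising3DConformalLimit.Theses.MarkovRigidity
import Summits.CriticalPhenomena.Ising3DConformalLimit.Theorems.MarkovRigidityHomogeneousEntireRigidityAux

/-!
# `HomogeneousEntireRigidity` — an entire, positively homogeneous `P ≥ 0` on `ℝ³` with
`1/P ∈ L¹_loc(ℝ³)` is a positive-definite quadratic form
(route MarkovRigidity of `Ising3DConformalLimit`, item stmt-CriticalPhenomena-6231: PROOF)

The support item records the "Gaussian shadow" of Nelson–Polyakov rigidity after Kotani's
criterion: if `P : ℂ³ → ℂ` is entire, real and `≥ 0` on `ℝ³`, not identically zero there,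
positively homogeneous of degree `m ∈ (0, 3)` on `ℝ³` and `1/P` is locally integrable on `ℝ³`,
then `m = 2` and `P|ℝ³` is the quadratic form of a positive-definite matrix
(`homogeneousEntireRigidity_proof`, literally the route decl `HomogeneousEntireRigidity`).

Proof (elementary; the lemmas are in
`Theorems/MarkovRigidityHomogeneousEntireRigidityAux.lean`, namespace
`…Theorems.HomogeneousEntireRigidity`):
1. for `k₀` with `P k₀ ≠ 0` the entire function `g t = P (t k₀)` equals `t ^ m P k₀` for `t > 0`,
   so `m ∈ ℕ` (`exists_nat_eq_of_entire_eq_rpow`), i.e. `m ∈ {1, 2}`;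
2. complex homogeneity `P (t k) = t ^ m P (k)` for `t ∈ ℂ`, `k ∈ ℝ³` (identity principle
   `entire_eq_of_eqOn_pos`); `m = 1` contradicts `P ≥ 0` (take `t = −1`);
3. for `m = 2`, `2 P (k) = (d/dt)² P (t k)|₀ = D²P(0)(k, k)` (`iteratedDeriv_two_comp_smul`,
   `bilin_expand`), so `Re P (k) = kᵀ Q k` with `Q` the symmetrised real part of `D²P(0)/4` on the
   standard basis — symmetric and, by `P ≥ 0`, positive semidefinite;
4. if `xᵀ Q x = 0` for some `x ≠ 0` then `Q x = 0` (`mulVec_eq_zero_of_psd`), the form is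
   invariant under translation by `ℝ x` (`quad_add_smul_ker`), and
   `eq_zero_of_locallyIntegrable_inv` (anisotropic-dilation invariance of `(1/q) dy` plus
   continuity from above) forces `Re P ≡ 0` on `ℝ³`, contradicting `P k₀ ≠ 0`. Hence `Q` is
   positive definite.

No definitions and no named facts are introduced; the result is unconditional.
-/

namespace Summit.CriticalPhenomena.Ising3DConformalLimit.Theorems

open Complex Filter Topology MeasureTheory Set
open scoped ENNReal Matrix

open HomogeneousEntireRigidity Summit.CriticalPhenomena.Ising3DConformalLimit.Theses in
/-- **`HomogeneousEntireRigidity`** (item stmt-CriticalPhenomena-6231 of route MarkovRigidity):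
if `P : ℂ³ → ℂ` is entire, real and `≥ 0` on `ℝ³`, not identically `0` on `ℝ³`, positively
homogeneous of degree `m ∈ (0,3)` on `ℝ³` and `1/P` is locally integrable on `ℝ³`, then `m = 2`
and `P|ℝ³` is a positive-definite quadratic form `k ↦ Σ Q i j k i k j`. -/
theorem homogeneousEntireRigidity_proof : MarkovRigidity.HomogeneousEntireRigidity := by
  intro m P hm0 hm3 hP hnz hreal hhom hint
  -- the real embedding `ℝ³ → ℂ³`
  set emb : (Fin 3 → ℝ) → (Fin 3 → ℂ) := fun k i => (k i : ℂ) with hemb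
  have hreal' : ∀ k : Fin 3 → ℝ, 0 ≤ (P (emb k)).re ∧ (P (emb k)).im = 0 := hreal
  have hint' : LocallyIntegrable (fun k : Fin 3 → ℝ => 1 / (P (emb k)).re) := hint
  have hhom' : ∀ (c : ℝ) (k : Fin 3 → ℝ), 0 < c →
      P ((c : ℂ) • emb k) = ((c ^ m : ℝ) : ℂ) * P (emb k) := by
    intro c k hc
    have h1 : ((c : ℂ) • emb k) = fun i => ((c * k i : ℝ) : ℂ) := by
      funext i; simp [hemb]
    rw [h1]
    exact hhom c k hc
  -- lines through the origin are entire
  have hline : ∀ (v : Fin 3 → ℂ) (z : ℂ), AnalyticAt ℂ (fun t : ℂ => P (t • v)) z := fun v z =>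
    (hP _).fun_comp (analyticAt_id.smul analyticAt_const)
  -- Step 1: `m` is a natural number
  obtain ⟨k₀, hk₀⟩ := hnz
  have hk₀' : P (emb k₀) ≠ 0 := hk₀
  obtain ⟨n, hn⟩ : ∃ n : ℕ, (n : ℝ) = m :=
    exists_nat_eq_of_entire_eq_rpow (hline (emb k₀)) hk₀' fun t ht => hhom' t k₀ ht
  subst hn
  have hn0 : 0 < n := by exact_mod_cast hm0
  have hn3 : n < 3 := by exact_mod_cast hm3
  -- Step 2: complex homogeneity along real directions
  have hhomC : ∀ (k : Fin 3 → ℝ) (t : ℂ), P (t • emb k) = t ^ n * P (emb k) := by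
    intro k
    have hfg := entire_eq_of_eqOn_pos (hline (emb k))
      (fun z => (analyticAt_id.pow n).mul analyticAt_const) (fun t ht => by
        show P ((t : ℂ) • emb k) = (t : ℂ) ^ n * P (emb k)
        rw [hhom' t k ht, Real.rpow_natCast]
        push_cast
        ring)
    intro t
    exact congrFun hfg t
  interval_cases n
  · -- Step 3: `m = 1` is impossible (`P (-k) = -P (k)` and `P ≥ 0` force `P ≡ 0` on `ℝ³`)
    exfalso
    apply hk₀'
    have h1 := hhomC k₀ (-1)
    have h2 : ((-1 : ℂ) • emb k₀) = emb (-k₀) := by funext i; simp [hemb]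
    rw [h2, pow_one, neg_one_mul] at h1
    have hr := (hreal' (-k₀)).1
    rw [h1, Complex.neg_re] at hr
    apply Complex.ext
    · simpa using le_antisymm (by linarith [(hreal' k₀).1]) (hreal' k₀).1
    · simpa using (hreal' k₀).2
  · -- Step 4: `m = 2`; `P|ℝ³` is the quadratic form of `B = D²P(0)`
    refine ⟨by norm_num, ?_⟩
    have hcd : ContDiff ℂ 2 P := AnalyticOnNhd.contDiff (fun z _ => hP z)
    set B : (Fin 3 → ℂ) →L[ℂ] (Fin 3 → ℂ) →L[ℂ] ℂ := fderiv ℂ (fderiv ℂ P) 0 with hB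
    have hPB : ∀ k : Fin 3 → ℝ, 2 * P (emb k) = B (emb k) (emb k) := by
      intro k
      rw [hB, ← iteratedDeriv_two_comp_smul hcd (emb k)]
      have hfun : (fun t : ℂ => P (t • emb k)) = fun t => t ^ 2 * P (emb k) := funext (hhomC k)
      rw [hfun, iteratedDeriv_two_sq_mul]
    set Q : Matrix (Fin 3) (Fin 3) ℝ := Matrix.of fun i j =>
      ((B (Pi.single i 1) (Pi.single j 1)).re + (B (Pi.single j 1) (Pi.single i 1)).re) / 4 with hQ
    have hQsymm : Q.transpose = Q := by
      ext i j; simp only [hQ, Matrix.transpose_apply, Matrix.of_apply]; ring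
    -- the representation formula
    have hrep : ∀ k : Fin 3 → ℝ, (P (emb k)).re = ∑ i, ∑ j, Q i j * k i * k j := by
      intro k
      have h2 := congrArg Complex.re (hPB k)
      rw [bilin_expand B (emb k)] at h2
      have hemb_apply : ∀ i, emb k i = (k i : ℂ) := fun i => rfl
      simp only [hemb_apply, ← Complex.ofReal_mul, Complex.re_sum, Complex.mul_re,
        Complex.re_ofNat, Complex.im_ofNat, Complex.ofReal_re, Complex.ofReal_im, zero_mul,
        sub_zero] at h2
      -- h2 : 2 * (P _).re = ∑ i, ∑ j, k i * k j * (B (Pi.single i 1) (Pi.single j 1)).re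
      have hswap : ∑ i, ∑ j, (B (Pi.single j 1) (Pi.single i 1)).re * k i * k j =
          ∑ i, ∑ j, (B (Pi.single i 1) (Pi.single j 1)).re * k i * k j := by
        rw [Finset.sum_comm]
        exact Finset.sum_congr rfl fun i _ => Finset.sum_congr rfl fun j _ => by ring
      have hS : ∑ i, ∑ j, Q i j * k i * k j =
          (1 / 2) * ∑ i, ∑ j, k i * k j * (B (Pi.single i 1) (Pi.single j 1)).re := by
        have : ∑ i, ∑ j, Q i j * k i * k j =
            (1 / 4) * (∑ i, ∑ j, (B (Pi.single i 1) (Pi.single j 1)).re * k i * k j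
              + ∑ i, ∑ j, (B (Pi.single j 1) (Pi.single i 1)).re * k i * k j) := by
          rw [← Finset.sum_add_distrib, Finset.mul_sum]
          refine Finset.sum_congr rfl fun i _ => ?_
          rw [← Finset.sum_add_distrib, Finset.mul_sum]
          refine Finset.sum_congr rfl fun j _ => ?_
          simp only [hQ, Matrix.of_apply]
          ring
        have hS' : ∑ i, ∑ j, k i * k j * (B (Pi.single i 1) (Pi.single j 1)).re =
            ∑ i, ∑ j, (B (Pi.single i 1) (Pi.single j 1)).re * k i * k j :=
          Finset.sum_congr rfl fun i _ => Finset.sum_congr rfl fun j _ => by ring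
        rw [this, hswap, hS']
        ring
      rw [hS]
      linarith [h2]
    -- the quadratic form of `Q`
    have hquad : ∀ x : Fin 3 → ℝ, x ⬝ᵥ (Q *ᵥ x) = ∑ i, ∑ j, Q i j * x i * x j := by
      intro x
      simp only [dotProduct, Matrix.mulVec, Finset.mul_sum]
      exact Finset.sum_congr rfl fun i _ => Finset.sum_congr rfl fun j _ => by ring
    have hq_eq : ∀ x, x ⬝ᵥ (Q *ᵥ x) = (P (emb x)).re := fun x => by rw [hquad, hrep]
    have hpsd : ∀ x, 0 ≤ x ⬝ᵥ (Q *ᵥ x) := fun x => by rw [hq_eq]; exact (hreal' x).1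
    refine ⟨Q, Matrix.PosDef.of_dotProduct_mulVec_pos (Matrix.IsHermitian.ext fun i j => ?_)
      fun x hx => ?_, hrep⟩
    · simp only [hQ, Matrix.of_apply, star_trivial]
      ring
    · rw [star_trivial]
      refine lt_of_le_of_ne (hpsd x) fun h0 => ?_
      -- an isotropic vector `x ≠ 0`: the form is invariant under `ℝ x`, so `1/P` cannot be
      -- locally integrable unless `P ≡ 0` on `ℝ³`
      have hker := mulVec_eq_zero_of_psd hQsymm hpsd h0.symm
      have hq_cont : Continuous fun y : Fin 3 → ℝ => (P (emb y)).re := by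
        have hc : Continuous fun y : Fin 3 → ℝ => ∑ i, ∑ j, Q i j * y i * y j := by fun_prop
        have hfe : (fun y : Fin 3 → ℝ => (P (emb y)).re) =
            fun y => ∑ i, ∑ j, Q i j * y i * y j := funext hrep
        rw [hfe]
        exact hc
      have hq_hom : ∀ (c : ℝ) (y : Fin 3 → ℝ),
          (P (emb (c • y))).re = c ^ 2 * (P (emb y)).re := by
        intro c y
        rw [← hq_eq, ← hq_eq, Matrix.mulVec_smul, dotProduct_smul, smul_dotProduct, smul_eq_mul,
          smul_eq_mul]
        ring
      have hq_inv : ∀ (y : Fin 3 → ℝ) (t : ℝ), (P (emb (y + t • x))).re = (P (emb y)).re := by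
        intro y t
        rw [← hq_eq, ← hq_eq]
        exact quad_add_smul_ker hQsymm hker y t
      have hzero := eq_zero_of_locallyIntegrable_inv hq_cont hq_hom hx hq_inv hint'
      apply hk₀'
      apply Complex.ext
      · simpa using hzero k₀
      · simpa using (hreal' k₀).2

end Summit.CriticalPhenomena.Ising3DConformalLimit.Theorems
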